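import Summits.QuantumFields.YangMills.Theorems.BalabanUVNodesN21LowCentreEndAtSUNBlockChartPackageCoerciveFlat
import Summits.QuantumFields.YangMills.Theorems.BalabanUVNodesN21WindowLetterAlgebra

/-!
# N21 (NE7c) · THE [LF-II] §1-LETTERS END ON THE EXPONENTIAL `SU(N)` BLOCK CHART, XIV: the flat-background per-fibre package (file 35) IN THE COMB GAUGE with
# junction №5's window letter `hlaw` DISCHARGED from a PLAQUETTE-SMALLNESS SUPPORT STATEMENT of the dressed density (file 22 §1b, pub-balaban's reach lemma) —
# the inner ∃-package of `htgA ∕ htgB` at `(T, U₀, c) = (combBonds lo hi, 1, 1)` with NO window letter, NO (1.7) row, NO matrix letter displayed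

Width seat pub-ymgap-dag-n21-w1 (g5; director-ym №197 ∕ HUMAN RULING D-0149), node N21 = NE7c (NOT PRINTED in [Bałaban 1983–89], NOT proved), lane K3⁸
`SpineGivenEndpointR13SepCoPHV` (stmt-QuantumFields-27366, KEY MAP v2; lineage K3⁷ 20544), `--kind proof --supports … --as helper`.  File 37 of the seat's chain — the knit of
file 35 (`…PackageCoerciveFlat`, p647115) with the seat's own file 22 (`…N21WindowLetterAlgebra`, p626068, §1b).  THEOREMS ONLY: 0 `def`, 0 `sorry`; count-neutral.  NO Theses
import.  Restates nothing; composes BY NAME.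

WHY.  dag-n21-w2 g4 (bus 2026-08-28 15:41Z): «junction №5's box … T := `combBonds lo hi` of the cube's enlarged box in the axial comb gauge (loop-free by
`T4TreeGaugeFixing.noClosedLoop_combBonds`), U₀ free, b ⊆ box ∖ comb; … your per-fibre packages plug into `htgA ∕ htgB` as they are».  Their `htgA ∕ htgB` ask, per
exterior field `x`, for an ∃-package `(S, c, R, U, A, f, D)` whose law clause reads
`(∏_b Haar).withDensity ((Gd ∘ fixTo T U₀)(x ⊕_b ·)) = (blockLaw b).withDensity (windowSU b c S · R)`.  At `(T, U₀) = (combBonds lo hi, 1)` this clause is file 22 §1b's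
★★ — PROVED from the support statement «`Gd` vanishes unless the box plaquettes are `a`-small» under pub-balaban's reach conditions — so the flat-background package of
file 35 needs NO window letter: this file composes the two.

WHAT IS PROVED ([bookkeeping]).  ★★ `chartPackage_of_sect1Letters_flat_of_support` — file 35's ★★ `chartPackage_of_sect1Letters_analyticLocal_flat` at `c := 1`,
`μ :=` the comb-fixed block fibre law of `Gd` at the exterior field `x`, `R := y ↦ Gd (fixTo (combBonds lo hi) 1 (x ⊕_b y))` (measurable from `Measurable Gd`), with
`hlaw := pi_withDensity_fixTo_comb_eq_blockLaw_window_mul hS₀ ha hn hN4 hrad Gd hGd b hbox hcomb x`.  Displayed: file 35's letters (the (1.2) identity reading the quadratic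
member as `N·⟪X_v, Δ_1 X_v⟫`, (1.6) on the linear member, the analyticity letter, the dressed presentation `hR` — now of `Gd ∘ fixTo ∘ (x ⊕_b ·)` along the chart about `1` —,
the reading `hread`, the statistic ∕ envelope ∕ odds binders, the clauses) + the support statement and reach arithmetic.

A6 (director-ym №189 (3)).  The new binders `hS₀ ∕ ha ∕ hn ∕ hN4 ∕ hrad ∕ hGd` are inhabited e.g. by `a = 0`, `n = max side`, `Gd` supported on `{PlaqSmallOn S₀ 0}`
(trivially by `Gd := 0`, for which `hR` forces the cut indicator to vanish on the window — a degenerate but honest inhabitant); the remaining binders are file 35's, witnessed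
jointly in the kernel by file 36 `…PackageCoerciveFlatWitness.cutChartLaw_flat_torus_binders_inhabited` at a concrete `d = 2` torus.  A joint kernel witness of THIS file's
full list (with a non-zero `Gd`) is not typed here.

HONEST FRAMING.  Composition BY NAME of the seat's files 22 ∕ 35 (dag-n21-w3 g6's p642865 ∕ p644322 and pub-balaban's reach lemma credited); FLAT background and comb gauge
ONLY; the support statement is a HYPOTHESIS about the dressed density (print's small-field characteristic functions make it plausible; NOT asserted here); the (1.2) reading,
the dressed presentation, the analyticity letter, the statistic binders, the odds and the clauses remain the consumer's HYPOTHESES (NODE O's term object ∕ located letters);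
the gauge-invariance rows of junction №5 (`GaugeInvariant (cubeDensityOfDatum₉ …)`, `GaugeInvariant (cubeStat …)`) are def-R's ∕ NODE O's and are NOT touched; nothing of
Bałaban's asserted; (M1) ∕ NE7c NOT PRINTED ∕ NOT proved; **N21 NOT discharged**; K3⁸ NOT claimed; counts unmoved (typed 28∕28 · discharged 5∕27); never a count claim; one
finite 𝕋⁴ at fixed ε — R4 would close only the conditional finite-𝕋⁴ rung `BalabanLadder.UV`, NOT the Yang–Mills mass gap (Clay); nothing about ℝ⁴ ∕ OS.  No decl below
carries a cite tag.
-/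

set_option autoImplicit false

noncomputable section

open MeasureTheory Set Function Finset Metric
open scoped ENNReal BigOperators Matrix InnerProductSpace RealInnerProductSpace

namespace Summit.QuantumFields.YangMills.Theorems.N21LowCentreEndAtSUNBlockChartPackageCoerciveFlatSupport

open Literature.MathematicalPhysics.QuantumFieldTheory.Balaban1983to89
open Literature.MathematicalPhysics.QuantumFieldTheory.Balaban1983to89.T4Continuum
open Literature.MathematicalPhysics.QuantumFieldTheory.Balaban1983to89.Node00 hiding dimSU
open Literature.MathematicalPhysics.QuantumFieldTheory.Balaban1983to89.T4ShellMeasure (SlotAntiConcentration)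
open Literature.MathematicalPhysics.QuantumFieldTheory.Balaban1983to89.T4ShellMeasureDet (blockLaw)
open Literature.MathematicalPhysics.QuantumFieldTheory.Balaban1983to89.B16Sect1Wilson (Ineq16)
open Literature.MathematicalPhysics.QuantumFieldTheory.Balaban1983to89.T4AxialGaugeSmallField (boxBonds boxPlaqs)
open Literature.MathematicalPhysics.QuantumFieldTheory.Balaban1983to89.T4AxialGaugeFixing (combBonds)
open Literature.MathematicalPhysics.QuantumFieldTheory.Balaban1983to89.T4TreeGaugeFixing (fixTo measurable_fixTo)
open T4AdjointCovarianceUnitary (lieSU)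
open Summit.QuantumFields.BalabanUV.T4Continuum
open Summit.QuantumFields.BalabanUV.T4Continuum.ShellMeasureExpChartSUN (SUN ChartSU BlockChartSU dimSU coordSU expFibreChartSU chartWeightSU)
open Summit.QuantumFields.BalabanUV.T4Continuum.ShellMeasureScalingSUN (windowSU)
open Summit.QuantumFields.BalabanUV.T4Continuum.ShellMeasureExpJacobianSUN (expJacWeightSU)
open Summit.QuantumFields.BalabanUV.T4Continuum.ShellMeasureExpHaarAreaSUN (kappaSU)
open Summit.QuantumFields.YangMills.Theorems.N21WindowLetterAlgebra (pi_withDensity_fixTo_comb_eq_blockLaw_window_mul)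
open Summit.QuantumFields.YangMills.Theorems.N21LowCentreEndAtSUNBlockChartPackageCoerciveFlat (chartPackage_of_sect1Letters_analyticLocal_flat)

variable {N : ℕ} [NeZero N] {P : Params} {j : ℕ} {lo hi : Fin P.d → ℤ}

/-- ★★ **THE PER-FIBRE CHART PACKAGE AT THE FLAT BACKGROUND IN THE COMB GAUGE, `hlaw` FROM A PLAQUETTE-SMALLNESS SUPPORT STATEMENT** — file 35's ★★
with junction №5's window letter DISCHARGED by file 22 §1b (`pi_withDensity_fixTo_comb_eq_blockLaw_window_mul`: pub-balaban's reach `mem_expWindowSU_of_comb`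
BY NAME): tree `T := combBonds lo hi`, reference `U₀ := 1`, centre `c := 1`, `R :=` the comb-fixed fibre density `y ↦ Gd (fixTo T 1 (x ⊕_b y))` itself; displayed
instead of `hlaw`: the support statement `hGd : Gd V ≠ 0 → PlaqSmallOn S₀ a V` (`S₀ ⊇ boxPlaqs lo hi`), the side bound `hi ≤ lo + n`, and the reach conditions
`N·((d−1)·n·a) < 4`, `√N·(π∕2)·((d−1)·n·a) ≤ S` (with `S < π`).  The conclusion is LITERALLY the inner ∃-package of junction №5's `htgA ∕ htgB`
(dag-n21-w2 file 19) at `(T, U₀) = (combBonds lo hi, 1)`. [bookkeeping] -/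
theorem chartPackage_of_sect1Letters_flat_of_support (hN : 2 ≤ N) (b : Finset (PBond P j)) (hb : b.Nonempty)
    {S : ℝ} (hS : 0 < S) (hSπ : S < Real.pi) (v : (↥b → SU N) → ℝ)
    (K₀ : Set (BlockChartSU N b)) (A lin Vt : BlockChartSU N b → ℝ)
    (hAm : Measurable fun z : BlockChartSU N b => K₀.indicator (fun w => ENNReal.ofReal (Real.exp (-A w))) z)
    {U : BlockChartSU N b → ℝ} (hUm : Measurable U)
    {C Env : Set (BlockChartSU N b)} (hC : MeasurableSet C) (hEnv : MeasurableSet Env)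
    {θ ρ σ κ₀ Q L B₃ M₀ A₀ p₀g Rk WV DK r S₂ : ℝ} (M : ℕ)
    (hθ : 0 < θ) (hρ0 : 0 < ρ) (hρ1 : ρ < 1) (hρσ : ρ + σ ≤ 1) (hκ : 0 < κ₀) (hQ0 : 0 ≤ Q) (hL : 0 < L)
    (hd : 1 ≤ P.d) (hM : 1 ≤ M) (hr : 0 < r) {η : ℝ} (hη : η ≠ 0)
    (hW : 0 ≤ 3 * B₃ * M₀ * A₀ ^ 2 * p₀g ^ 2 * Real.exp (-Rk) * (100 * (M : ℝ)) ^ 4 + WV)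
    (hK₀ : Convex ℝ K₀) (h0K₀ : (0 : BlockChartSU N b) ∈ K₀)
    (hexp : ∀ w ∈ K₀, A w = A 0 + 1 / 2 * ((N : ℝ) * ⟪((WithLp.toLp 2 fun bd' : PBond P j => if h : bd' ∈ b then coordSU (w ⟨bd', h⟩) else (0 : lieSU (Fin N))) : TangentBondSU P j N),
        hessOpAt η (1 : GaugeField P j (SU N)) ((WithLp.toLp 2 fun bd' : PBond P j => if h : bd' ∈ b then coordSU (w ⟨bd', h⟩) else (0 : lieSU (Fin N))) : TangentBondSU P j N)⟫_ℝ) + lin w + Vt w)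
    -- a block `b` of box bonds off the comb of the non-wrapping box `[lo, hi]`: with `η ≠ 0` above, `h19` is a THEOREM at `U₀ = 1`
    (hwrap : ∀ κ, hi κ - lo κ < P.sitesPerDir j) (hsides : ∀ κ, hi κ + 1 - lo κ ≤ 100 * M)
    (hbox : ∀ i ∈ b, i ∈ (boxBonds lo hi : Set (PBond P j)))
    (hcomb : ∀ i ∈ b, i ∉ (combBonds lo hi : Finset (PBond P j)))
    -- the SUPPORT STATEMENT replacing `hlaw`: the dressed density `Gd` vanishes unless the box plaquettes are `a`-small; pub-balaban's reach
    -- conditions on `(N, d, n, a, S)`; the exterior field `x` of the fibre (comb gauge `T := combBonds lo hi`, reference `U₀ := 1`, centre `c := 1`)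
    {a : ℝ} {S₀ : Set (Plaq P j)} {n : ℕ} (hS₀ : boxPlaqs lo hi ⊆ S₀) (ha : 0 ≤ a) (hn : ∀ κ, hi κ ≤ lo κ + n)
    (hN4 : (N : ℝ) * (((P.d - 1 : ℕ) : ℝ) * n * a) < 4)
    (hrad : Real.sqrt N * (Real.pi / 2 * (((P.d - 1 : ℕ) : ℝ) * n * a)) ≤ S)
    (Gd : GaugeField P j (SU N) → ℝ≥0∞) (hGdm : Measurable Gd) (hGd : ∀ V, Gd V ≠ 0 → PlaqSmallOn S₀ a V)
    (x : GaugeField P j (SU N))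
    (ℓ : BlockChartSU N b →ₗ[ℝ] ℝ) (hlin : ∀ w, lin w = ℓ w)
    (h16 : ∀ w ∈ K₀, Ineq16 (lin w) B₃ M₀ A₀ p₀g Rk M)
    (hV : ∀ w ∈ K₀, |Vt w| ≤ WV)
    (Φ : (↥b × Fin (dimSU N) → ℂ) → ℂ)
    (hVt : ∀ x ∈ K₀, Vt x = (Φ fun q => ((x q.1 q.2 : ℝ) : ℂ)).re)
    (hΦd : ∀ x ∈ K₀, DifferentiableOn ℂ Φ (ball (fun q => ((x q.1 q.2 : ℝ) : ℂ)) r))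
    (hΦS : ∀ x ∈ K₀, ∀ u ∈ ball (fun q : ↥b × Fin (dimSU N) => ((x q.1 q.2 : ℝ) : ℂ)) r, ‖Φ u‖ ≤ S₂)
    (hclause₂ : 4 * P.d * (100 * (M : ℝ)) ^ (P.d + 1) * S₂ ≤ r ^ 2)
    (hR : ∀ z ∈ closedBall (0 : BlockChartSU N b) S,
      Gd (fixTo (combBonds lo hi) 1 (Function.updateFinset x b (expFibreChartSU b (1 : GaugeField P j (SU N)) z))) =
      ({z | U z < θ} ∩ C).indicator (fun z' => K₀.indicator (fun w => ENNReal.ofReal (Real.exp (-A w))) z') z)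
    (hread : ∀ z ∈ closedBall (0 : BlockChartSU N b) S, v (expFibreChartSU b (1 : GaugeField P j (SU N)) z) = U z)
    (hUL : ∀ z z' : BlockChartSU N b, U z - U z' ≤ L * ‖z - z'‖)
    (hUc : U 0 ≤ σ * θ)
    (hclause : 16 * (3 * B₃ * M₀ * A₀ ^ 2 * p₀g ^ 2 * Real.exp (-Rk) * (100 * (M : ℝ)) ^ 4 +
        (WV + b.card * ((N * N : ℕ) * (-2 * Real.log (Real.sinc S))))) * P.d
      * (100 * (M : ℝ)) ^ (P.d + 1) * (dimSU N * L ^ 2) ≤ (θ * (1 - ρ - σ)) ^ 2)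
    (henv : ∀ l ∈ Icc (1 - 1 / ((b.card : ℝ) * dimSU N + 1)) 1, ∀ z : BlockChartSU N b,
      θ * (1 - ρ) ≤ U z → U z < θ → z ∈ C → l • z ∈ Env)
    (hRT : ∀ z : BlockChartSU N b, θ * (1 - ρ) ≤ U z → U z < θ → z ∈ C → ∀ s' : ℝ, 1 ≤ s' →
      θ * (1 - ρ) ≤ U (s' • z) → U (s' • z) < θ → s' • z ∈ C → U z + κ₀ * (θ * (1 - ρ)) * (s' - 1) ≤ U (s' • z))
    (hQ : ((volume : Measure (BlockChartSU N b)).withDensity fun z =>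
        chartWeightSU b S (expJacWeightSU (kappaSU N)) z * K₀.indicator (fun w => ENNReal.ofReal (Real.exp (-A w))) z)
          (Env \ ({z | U z < θ} ∩ C))
      ≤ ENNReal.ofReal Q * ((volume : Measure (BlockChartSU N b)).withDensity fun z =>
        chartWeightSU b S (expJacWeightSU (kappaSU N)) z * K₀.indicator (fun w => ENNReal.ofReal (Real.exp (-A w))) z)
          ({z | U z < θ} ∩ C))
    (hD : 3 * ((b.card : ℝ) * dimSU N + 1) * (1 + Q) / (κ₀ * (1 - ρ)) ≤ DK) :
    ∃ (S' : ℝ) (c' : GaugeField P j (SU N)) (R' : (↥b → SU N) → ℝ≥0∞) (U' : BlockChartSU N b → ℝ)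
      (A' : Set (BlockChartSU N b)) (f : BlockChartSU N b → ℝ≥0∞) (D : ℝ),
      0 ≤ S' ∧ S' ≤ Real.pi ∧ Measurable R' ∧
      (Measure.pi fun _ : ↥b => (HaarData.haar : Measure (SU N))).withDensity
          (fun y => Gd (fixTo (combBonds lo hi) 1 (Function.updateFinset x b y)))
        = (blockLaw b).withDensity (fun y => windowSU b c' S' y * R' y) ∧
      MeasurableSet A' ∧
      (∀ z ∈ closedBall (0 : BlockChartSU N b) S', v (expFibreChartSU b c' z) = U' z) ∧
      ((fun z : BlockChartSU N b => chartWeightSU b S' (expJacWeightSU (kappaSU N)) z * R' (expFibreChartSU b c' z))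
        =ᵐ[volume] A'.indicator f) ∧
      SlotAntiConcentration (((volume : Measure (BlockChartSU N b)).withDensity f).restrict A') U' θ ρ D ∧
      D ≤ DK := by
  -- junction №5's window letter `hlaw` in the comb gauge FROM THE SUPPORT STATEMENT (file 22 §1b ★★, pub-balaban's reach BY NAME)
  have hRm : Measurable fun y : ↥b → SU N => Gd (fixTo (combBonds lo hi) 1 (Function.updateFinset x b y)) :=
    hGdm.comp ((measurable_fixTo _ _).comp measurable_updateFinset)
  have hlaw : ((Measure.pi fun _ : ↥b => (HaarData.haar : Measure (SU N))).withDensity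
        fun y => Gd (fixTo (combBonds lo hi) 1 (Function.updateFinset x b y))) =
      (blockLaw b).withDensity fun y => windowSU b (1 : GaugeField P j (SU N)) S y *
        (fun y' : ↥b → SU N => Gd (fixTo (combBonds lo hi) 1 (Function.updateFinset x b y'))) y :=
    pi_withDensity_fixTo_comb_eq_blockLaw_window_mul hS₀ ha hn hN4 hrad Gd hGd b hbox hcomb x
  exact chartPackage_of_sect1Letters_analyticLocal_flat hN b hb
    ((Measure.pi fun _ : ↥b => (HaarData.haar : Measure (SU N))).withDensity
      fun y => Gd (fixTo (combBonds lo hi) 1 (Function.updateFinset x b y)))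
    hS hSπ (1 : GaugeField P j (SU N)) (R := fun y' : ↥b → SU N => Gd (fixTo (combBonds lo hi) 1 (Function.updateFinset x b y')))
    hRm hlaw v K₀ A lin Vt hAm hUm hC hEnv M hθ hρ0 hρ1 hρσ hκ hQ0 hL hd hM hr hη hW hK₀ h0K₀ hexp hwrap hsides hbox hcomb ℓ hlin h16 hV Φ hVt hΦd hΦS
    hclause₂ hR hread hUL hUc hclause henv hRT hQ hD

end Summit.QuantumFields.YangMills.Theorems.N21LowCentreEndAtSUNBlockChartPackageCoerciveFlatSupport

end
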